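import Summits.Ventures.CertifiedManyBodySolver.Theorems.TcThermcert1HighTempExpansion
import Summits.Ventures.CertifiedManyBodySolver.Theorems.TcThermcert1FreeGasSectorBounds
import Summits.Ventures.CertifiedManyBodySolver.Theorems.TcThermcert1QbpSectorBookkeeping
import Summits.Ventures.CertifiedManyBodySolver.Theorems.TcThermcert1QbpLocalPerturbation
import Literature.Analysis.Complex.IteratedDifferenceBound
import Literature.MathematicalPhysics.QuantumLattice.LieTrotter
import Literature.MathematicalPhysics.QuantumLattice.TransferOperatorDual
import HarnessLib

/-!
# High-temperature current clustering for TcThermcert1's Hypothesis C — part 4a: bounds on the polymer terms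

Helper file for route `TcThermcert1` (crux K1′ `ThermalStiffnessCeilingU8b8_le_7o44`, item `stmt-Ventures-24560`; line
`Cruxes/ThermalStiffnessCeilingU8b8_le_7o44/Lines/gauge_qbp_far_seam.lean`, small-`β` rung `stub_currentClustering8_smallBeta`).
Estimates for the terms of the polymer expansion of part 3 (`H = Σ_Z h_Z`, `h_Z = hubbardTermOp G t U μ Z`, `E = 2|t| + |U| + 2|μ|`):

* §1 the polymer term is an ITERATED FINITE DIFFERENCE, in the couplings of the terms of `K`, of the entire function
  `c ↦ tr(P_{M,N} exp(Σ_Z c_Z h_Z) F B)`; the Cauchy bound of `Literature.Analysis.Complex.IteratedDifferenceBound` (step `−β`, radius `1`)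
  and `|tr(P_{M,N} e^{Σ c_Z h_Z} e^{−βH'} B)| ≤ ‖B‖ e^{Σ|c_Z|‖h_Z‖} tr(P_{M,N} e^{−βH'})` (projected Gibbs weights are positive) give
  `|tr(P_{M,N} ρ_K e^{−βH'} B)| ≤ (β e^{(β+1)E})^{|K|} ‖B‖ Re tr(P_{M,N} e^{−βH'})`;
* §2 removing terms costs at most `e^{β ‖removed‖}` on a sector partition function (free-energy Lipschitz bound on the compressions);
* §3 counting: the terms that are NOT far from an admissible `K` touch the reached region, which has at most `2 + 2|K|` sites, so there are
  at most `(2 + 2|K|)(2Δ+1)` of them on a graph of maximal degree `Δ`, and `‖H − H_{far(K)}‖ ≤ (2 + 2|K|)(2Δ+1) E`.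

[cite: Ueltschi1999, §2.3 (|ρ(𝒜)| ≤ Π (e^{β‖T‖} − 1))]; [cite: FriedliVelenik2017, §5.2]. HONEST FRAMING: high-temperature estimates
only; no `T_c` claim; K1′/K1 remain CONDITIONAL ceilings; superconductivity in the Hubbard model is NOT proved here. No definitions;
no `sorry`.
-/

noncomputable section

namespace Summit.Ventures.CertifiedManyBodySolver.Theorems.TcThermcert1.HighTempCurrentClustering

open Matrix Finset
open Literature.MathematicalPhysics.QuantumLattice
open Literature.Probability.LatticeModels
open Literature.Analysis.Complex.FiniteDifference
open Summit.Ventures.CertifiedManyBodySolver.Theorems.TcThermcert1.GaugeQbpFarSeam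
open Summit.Ventures.CertifiedManyBodySolver.Theorems.TcThermcert1.FreeGasCurrentClustering
open scoped Matrix.Norms.L2Operator ComplexOrder Classical

variable {Λ : Type*} [LinearOrder Λ] [Fintype Λ] (G : SimpleGraph Λ) [DecidableRel G.Adj] (t U μ : ℝ)

/-! ## §1 The polymer term as an iterated difference of an entire function, and its Cauchy bound -/

/-- The coupling-dependent trace `c ↦ tr(P · exp(Σ_Z c_Z h_Z) · F · B)` is an entire function of the couplings. [folklore] -/
theorem differentiable_trace_exp_coupling (P F B : Matrix (Finset (Orb Λ)) (Finset (Orb Λ)) ℂ) :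
    Differentiable ℂ (fun c : HubbardIdx G → ℂ =>
      (P * NormedSpace.exp (∑ Z, c Z • hubbardTermOp G t U μ Z) * F * B).trace) := by
  have hlin : Differentiable ℂ (fun c : HubbardIdx G → ℂ => ∑ Z, c Z • hubbardTermOp G t U μ Z) := by fun_prop
  have hexp : Differentiable ℂ (fun Y : Matrix (Finset (Orb Λ)) (Finset (Orb Λ)) ℂ => NormedSpace.exp Y) :=
    fun Y => (NormedSpace.exp_analytic (𝕂 := ℂ) Y).differentiableAt
  have htr : Differentiable ℂ (fun Y : Matrix (Finset (Orb Λ)) (Finset (Orb Λ)) ℂ => Y.trace) :=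
    (Matrix.traceLinearMap (Finset (Orb Λ)) ℂ ℂ).toContinuousLinearMap.differentiable
  exact htr.comp ((((differentiable_const P).mul (hexp.comp hlin)).mul (differentiable_const F)).mul (differentiable_const B))

omit [DecidableRel G.Adj] in
/-- The exponent at the coupling `τ · 1_T`: `Σ_Z (τ 1_T)_Z h_Z = τ Σ_{Z ∈ T} h_Z`. [folklore] -/
theorem sum_indicator_smul_hubbardTermOp [DecidableRel G.Adj] (τ : ℂ) (T : Finset (HubbardIdx G)) :
    ∑ Z, ((0 : HubbardIdx G → ℂ) + τ • Set.indicator (↑T : Set (HubbardIdx G)) (1 : HubbardIdx G → ℂ)) Z • hubbardTermOp G t U μ Z =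
      τ • ∑ Z ∈ T, hubbardTermOp G t U μ Z := by
  rw [zero_add, Finset.smul_sum]
  have h : ∀ Z : HubbardIdx G, (τ • Set.indicator (↑T : Set (HubbardIdx G)) (1 : HubbardIdx G → ℂ)) Z • hubbardTermOp G t U μ Z =
      if Z ∈ T then τ • hubbardTermOp G t U μ Z else 0 := fun Z => by
    rw [Pi.smul_apply, indicator_coe_apply, smul_eq_mul]
    split_ifs <;> simp
  rw [Finset.sum_congr rfl fun Z _ => h Z, Finset.sum_ite_mem, Finset.univ_inter]

/-- **The polymer term is an iterated difference** of `c ↦ tr(P exp(Σ c_Z h_Z) F B)` with step `−β` in the couplings of `K`: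
`tr(P ρ_K F B) = Δ^{−β}_K [c ↦ tr(P e^{Σ c_Z h_Z} F B)](0)`. [cite: Ueltschi1999, §2.3] -/
theorem trace_term_eq_iterDiff (β : ℝ) (P F B : Matrix (Finset (Orb Λ)) (Finset (Orb Λ)) ℂ) (K : Finset (HubbardIdx G)) :
    (P * ((∑ T ∈ K.powerset, ((-1 : ℂ) ^ (K \ T).card) • gibbsWeight β (∑ Z ∈ T, hubbardTermOp G t U μ Z)) * F) * B).trace =
      iterDiff (-(β : ℂ)) K (fun c : HubbardIdx G → ℂ =>
        (P * NormedSpace.exp (∑ Z, c Z • hubbardTermOp G t U μ Z) * F * B).trace) 0 := by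
  rw [iterDiff, Finset.sum_mul, Finset.mul_sum, Finset.sum_mul, Matrix.trace_sum]
  refine Finset.sum_congr rfl fun T _ => ?_
  rw [smul_mul_assoc, Matrix.mul_smul, smul_mul_assoc, trace_smul, smul_eq_mul, sum_indicator_smul_hubbardTermOp G t U μ,
    gibbsWeight, ← Matrix.mul_assoc P]

/-- **A sector-projected trace against a complex-coupling Boltzmann factor** is bounded by the operator norm times the projected partition
function: `|tr(P_{M,N} e^{Σ c_Z h_Z} e^{−βH'} B)| ≤ ‖B‖ e^{Σ_Z |c_Z| ‖h_Z‖} Re tr(P_{M,N} e^{−βH'})` for `H'` Hermitian and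
sector preserving (the complex exponential commutes with `P_{M,N}`, the projected Gibbs weight is positive). [folklore] -/
theorem norm_trace_proj_exp_coupling_le (M N : ℕ) (β : ℝ) {H' : Matrix (Finset (Orb Λ)) (Finset (Orb Λ)) ℂ}
    (hH' : H'.IsHermitian) (hP' : PreservesSectors H') (B : Matrix (Finset (Orb Λ)) (Finset (Orb Λ)) ℂ)
    (c : HubbardIdx G → ℂ) :
    ‖(spinSectorProj M N * NormedSpace.exp (∑ Z, c Z • hubbardTermOp G t U μ Z) * gibbsWeight β H' * B).trace‖ ≤
      ‖B‖ * Real.exp (∑ Z, ‖c Z‖ * ‖hubbardTermOp G t U μ Z‖) * ((spinSectorProj M N * gibbsWeight β H').trace).re := by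
  have hcomm : spinSectorProj M N * NormedSpace.exp (∑ Z, c Z • hubbardTermOp G t U μ Z) =
      NormedSpace.exp (∑ Z, c Z • hubbardTermOp G t U μ Z) * spinSectorProj M N :=
    (Commute.sum_right _ _ _ fun Z _ => Commute.smul_right
      (show Commute (spinSectorProj M N) (hubbardTermOp G t U μ Z) from
        spinSectorProj_mul_comm_of_preservesSectors (preservesSectors_hubbardTermOp G t U μ Z) M N) (c Z)).exp_right.eq
  have hre : (spinSectorProj M N * NormedSpace.exp (∑ Z, c Z • hubbardTermOp G t U μ Z) * gibbsWeight β H' * B).trace =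
      ((spinSectorProj M N * gibbsWeight β H') * (B * NormedSpace.exp (∑ Z, c Z • hubbardTermOp G t U μ Z))).trace := by
    rw [hcomm, Matrix.mul_assoc, Matrix.mul_assoc, Matrix.trace_mul_comm, ← Matrix.mul_assoc, ← Matrix.mul_assoc]
  rw [hre]
  have hpsd := posSemidef_spinSectorProj_mul_gibbsWeight hH' hP' β M N
  have hZ : 0 ≤ ((spinSectorProj M N * gibbsWeight β H').trace).re := (Complex.nonneg_iff.1 hpsd.trace_nonneg).1
  refine (norm_trace_mul_le_of_posSemidef hpsd _).trans ?_
  have hE : ‖NormedSpace.exp (∑ Z, c Z • hubbardTermOp G t U μ Z)‖ ≤ Real.exp (∑ Z, ‖c Z‖ * ‖hubbardTermOp G t U μ Z‖) := by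
    refine (norm_exp_le (𝕂 := ℂ) _).trans (Real.exp_le_exp.2 ((norm_sum_le _ _).trans (Finset.sum_le_sum fun Z _ => ?_)))
    rw [norm_smul]
  calc ‖B * NormedSpace.exp (∑ Z, c Z • hubbardTermOp G t U μ Z)‖ * ((spinSectorProj M N * gibbsWeight β H').trace).re
      ≤ (‖B‖ * Real.exp (∑ Z, ‖c Z‖ * ‖hubbardTermOp G t U μ Z‖)) * ((spinSectorProj M N * gibbsWeight β H').trace).re := by
        gcongr
        exact (norm_mul_le _ _).trans (by gcongr)
    _ = _ := by ring

/-- **Cauchy bound on the polymer term.** For `β ≥ 0`, `H'` Hermitian and sector preserving, any `B`, and any set of terms `K`: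
`|tr(P_{M,N} ρ_K e^{−βH'} B)| ≤ (β · e^{(β+1)E})^{|K|} · ‖B‖ · Re tr(P_{M,N} e^{−βH'})`, `E = 2|t|+|U|+2|μ|` (iterated difference with
step `−β`, Cauchy radius `1`). [cite: Ueltschi1999, §2.3] -/
theorem norm_trace_term_le {β : ℝ} (hβ : 0 ≤ β) (M N : ℕ) {H' : Matrix (Finset (Orb Λ)) (Finset (Orb Λ)) ℂ}
    (hH' : H'.IsHermitian) (hP' : PreservesSectors H') (B : Matrix (Finset (Orb Λ)) (Finset (Orb Λ)) ℂ) (K : Finset (HubbardIdx G)) :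
    ‖(spinSectorProj M N * ((∑ T ∈ K.powerset, ((-1 : ℂ) ^ (K \ T).card) • gibbsWeight β (∑ Z ∈ T, hubbardTermOp G t U μ Z)) *
        gibbsWeight β H') * B).trace‖ ≤
      (β * Real.exp ((β + 1) * (2 * |t| + |U| + 2 * |μ|))) ^ K.card * ‖B‖ * ((spinSectorProj M N * gibbsWeight β H').trace).re := by
  rw [trace_term_eq_iterDiff G t U μ β]
  have hZ : 0 ≤ ((spinSectorProj M N * gibbsWeight β H').trace).re :=
    (Complex.nonneg_iff.1 (posSemidef_spinSectorProj_mul_gibbsWeight hH' hP' β M N).trace_nonneg).1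
  have hnβ : ‖(-(β : ℂ))‖ = β := by rw [norm_neg, Complex.norm_real, Real.norm_of_nonneg hβ]
  have hB : ∀ c' : HubbardIdx G → ℂ, (∀ Z, ‖c' Z‖ ≤ ‖(-(β : ℂ))‖ + 1) → (∀ Z ∉ K, c' Z = 0) →
      ‖(spinSectorProj M N * NormedSpace.exp (∑ Z, c' Z • hubbardTermOp G t U μ Z) * gibbsWeight β H' * B).trace‖ ≤
        Real.exp ((β + 1) * (2 * |t| + |U| + 2 * |μ|) * K.card) * ‖B‖ * ((spinSectorProj M N * gibbsWeight β H').trace).re := by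
    intro c' hc' hc'0
    refine (norm_trace_proj_exp_coupling_le G t U μ M N β hH' hP' B c').trans ?_
    have hsum : ∑ Z, ‖c' Z‖ * ‖hubbardTermOp G t U μ Z‖ ≤ (β + 1) * (2 * |t| + |U| + 2 * |μ|) * K.card := by
      rw [← Finset.sum_subset (Finset.subset_univ K) (fun Z _ hZ => by rw [hc'0 Z hZ, norm_zero, zero_mul])]
      calc ∑ Z ∈ K, ‖c' Z‖ * ‖hubbardTermOp G t U μ Z‖ ≤ ∑ _Z ∈ K, (β + 1) * (2 * |t| + |U| + 2 * |μ|) :=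
            Finset.sum_le_sum fun Z _ => mul_le_mul ((hc' Z).trans (by rw [hnβ])) (norm_hubbardTermOp_le G t U μ Z)
              (norm_nonneg _) (by positivity)
        _ = (β + 1) * (2 * |t| + |U| + 2 * |μ|) * K.card := by rw [Finset.sum_const, nsmul_eq_mul]; ring
    calc ‖B‖ * Real.exp (∑ Z, ‖c' Z‖ * ‖hubbardTermOp G t U μ Z‖) * ((spinSectorProj M N * gibbsWeight β H').trace).re
        ≤ ‖B‖ * Real.exp ((β + 1) * (2 * |t| + |U| + 2 * |μ|) * K.card) * ((spinSectorProj M N * gibbsWeight β H').trace).re := by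
          gcongr
      _ = _ := by ring
  refine (norm_iterDiff_zero_le (differentiable_trace_exp_coupling G t U μ _ _ _) one_pos K hB).trans (le_of_eq ?_)
  rw [hnβ, div_one, mul_pow, ← Real.exp_nat_mul]
  ring_nf

/-! ## §2 Removing terms from a sector partition function -/

/-- **Sector free-energy Lipschitz bound**: for Hermitian sector-preserving `H₁, H₂` with `‖H₁ − H₂‖ ≤ r`, `β ≥ 0` and a nonempty sector
`(M,N)`, `Re tr(P_{M,N} e^{−βH₁}) ≤ e^{βr} Re tr(P_{M,N} e^{−βH₂})`. [folklore] -/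
theorem re_trace_proj_gibbsWeight_le_exp_mul {β : ℝ} (hβ : 0 ≤ β) (M N : ℕ)
    {H₁ H₂ : Matrix (Finset (Orb Λ)) (Finset (Orb Λ)) ℂ} (h₁ : H₁.IsHermitian) (h₂ : H₂.IsHermitian)
    (hp₁ : PreservesSectors H₁) (hp₂ : PreservesSectors H₂) (hne : ∃ s : Finset (Orb Λ), (upPart s).card = M ∧ (downPart s).card = N)
    {r : ℝ} (hr : ‖H₁ - H₂‖ ≤ r) :
    ((spinSectorProj M N * gibbsWeight β H₁).trace).re ≤ Real.exp (β * r) * ((spinSectorProj M N * gibbsWeight β H₂).trace).re := by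
  let p : Finset (Orb Λ) → Prop := fun s => (upPart s).card = M ∧ (downPart s).card = N
  have hp : ∀ s, p s ↔ (upPart s).card = M ∧ (downPart s).card = N := fun s => Iff.rfl
  rw [trace_spinSectorProj_mul_gibbsWeight hp₁ β p hp, trace_spinSectorProj_mul_gibbsWeight hp₂ β p hp]
  haveI : Nonempty {s // p s} := by obtain ⟨s, hs⟩ := hne; exact ⟨⟨s, hs⟩⟩
  have hZ1 := partitionFn_re_pos (isHermitian_toBlock p h₁) β
  have hZ2 := partitionFn_re_pos (isHermitian_toBlock p h₂) β
  have hlog := abs_log_partitionFn_sub_log_partitionFn_le (isHermitian_toBlock p h₁) (isHermitian_toBlock p h₂) hβ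
  have hsub : H₁.toBlock p p - H₂.toBlock p p = (H₁ - H₂).toBlock p p := rfl
  have hnorm : ‖H₁.toBlock p p - H₂.toBlock p p‖ ≤ r := by rw [hsub]; exact norm_toBlock_le_of_le p hr
  have h1 : Real.log (partitionFn β (H₁.toBlock p p)).re ≤ Real.log (partitionFn β (H₂.toBlock p p)).re + β * r := by
    have h := (abs_le.1 hlog).2
    nlinarith [mul_le_mul_of_nonneg_left hnorm hβ]
  calc (partitionFn β (H₁.toBlock p p)).re = Real.exp (Real.log (partitionFn β (H₁.toBlock p p)).re) := (Real.exp_log hZ1).symm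
    _ ≤ Real.exp (Real.log (partitionFn β (H₂.toBlock p p)).re + β * r) := Real.exp_le_exp.2 h1
    _ = Real.exp (β * r) * (partitionFn β (H₂.toBlock p p)).re := by rw [Real.exp_add, Real.exp_log hZ2, mul_comm]

/-! ## §3 Counting the terms that are not far from an admissible set -/

omit [Fintype Λ] [DecidableRel G.Adj] in
/-- A term has at most two sites. [folklore] -/
theorem card_hubbardTermSupp_le_two (Z : HubbardIdx G) : (hubbardTermSupp G Z).card ≤ 2 := by
  cases Z with
  | inl p => exact (Finset.card_insert_le _ _).trans (by simp)
  | inr x => simp [hubbardTermSupp]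

omit [DecidableRel G.Adj] in
/-- **The reached region is small**: the sites reachable from `{a,b}` through `K` number at most `2 + 2|K|`
(they are roots or sites of terms of `K`). [folklore] -/
theorem card_reach_le (a b : Λ) (K : Finset (HubbardIdx G)) :
    (Finset.univ.filter (fun y => ∃ r ∈ ({a, b} : Finset Λ), Relation.ReflTransGen
        (fun x y : Λ => ∃ Z ∈ K, x ∈ hubbardTermSupp G Z ∧ y ∈ hubbardTermSupp G Z) r y)).card ≤ 2 + 2 * K.card := by
  have hsub : Finset.univ.filter (fun y => ∃ r ∈ ({a, b} : Finset Λ), Relation.ReflTransGen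
      (fun x y : Λ => ∃ Z ∈ K, x ∈ hubbardTermSupp G Z ∧ y ∈ hubbardTermSupp G Z) r y) ⊆
      {a, b} ∪ K.biUnion (hubbardTermSupp G) := by
    intro y hy
    obtain ⟨r, hr, hry⟩ := (Finset.mem_filter.1 hy).2
    rcases eq_or_exists_cell_of_reach hry with rfl | ⟨Z, hZ, hyZ⟩
    · exact Finset.mem_union_left _ hr
    · exact Finset.mem_union_right _ (Finset.mem_biUnion.2 ⟨Z, hZ, hyZ⟩)
  refine (Finset.card_le_card hsub).trans ((Finset.card_union_le _ _).trans ?_)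
  have h1 : ({a, b} : Finset Λ).card ≤ 2 := (Finset.card_insert_le _ _).trans (by simp)
  have h2 : (K.biUnion (hubbardTermSupp G)).card ≤ K.card * 2 :=
    Finset.card_biUnion_le_card_mul _ _ _ fun Z _ => card_hubbardTermSupp_le_two G Z
  omega

/-- **The non-far terms are few**: on a graph of maximal degree `Δ`, the terms of which some site is reachable from `{a,b}` through `K`
number at most `(2 + 2|K|)(2Δ+1)`. [folklore] -/
theorem card_not_far_le {Δ : ℕ} (hΔ : ∀ x : Λ, (Finset.univ.filter fun y => G.Adj x y).card ≤ Δ) (a b : Λ)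
    (K : Finset (HubbardIdx G)) :
    (Finset.univ.filter (fun Z : HubbardIdx G => ¬ ∀ w ∈ hubbardTermSupp G Z, ¬ ∃ r ∈ ({a, b} : Finset Λ),
        Relation.ReflTransGen (fun x y : Λ => ∃ Z ∈ K, x ∈ hubbardTermSupp G Z ∧ y ∈ hubbardTermSupp G Z) r w)).card ≤
      (2 + 2 * K.card) * (2 * Δ + 1) := by
  set S := Finset.univ.filter (fun y => ∃ r ∈ ({a, b} : Finset Λ), Relation.ReflTransGen
    (fun x y : Λ => ∃ Z ∈ K, x ∈ hubbardTermSupp G Z ∧ y ∈ hubbardTermSupp G Z) r y) with hS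
  have hsub : Finset.univ.filter (fun Z : HubbardIdx G => ¬ ∀ w ∈ hubbardTermSupp G Z, ¬ ∃ r ∈ ({a, b} : Finset Λ),
      Relation.ReflTransGen (fun x y : Λ => ∃ Z ∈ K, x ∈ hubbardTermSupp G Z ∧ y ∈ hubbardTermSupp G Z) r w) ⊆
      Finset.univ.filter (fun Z : HubbardIdx G => ¬ Disjoint (hubbardTermSupp G Z) S) := by
    intro Z hZ
    have h := (Finset.mem_filter.1 hZ).2
    push Not at h
    obtain ⟨w, hw, hrw⟩ := h
    refine Finset.mem_filter.2 ⟨Finset.mem_univ _, fun hd => ?_⟩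
    exact Finset.disjoint_left.1 hd hw (Finset.mem_filter.2 ⟨Finset.mem_univ _, hrw⟩)
  refine (Finset.card_le_card hsub).trans ((card_filter_not_disjoint_hubbardTermSupp_le G hΔ S).trans ?_)
  exact Nat.mul_le_mul_right _ (card_reach_le G a b K)

/-- **Norm of the removed terms**: `‖Σ_Z h_Z − Σ_{Z ∈ far(K)} h_Z‖ ≤ (2 + 2|K|)(2Δ+1) · E`. [folklore] -/
theorem norm_sum_sub_sum_far_le {Δ : ℕ} (hΔ : ∀ x : Λ, (Finset.univ.filter fun y => G.Adj x y).card ≤ Δ) (a b : Λ)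
    (K : Finset (HubbardIdx G)) :
    ‖∑ Z, hubbardTermOp G t U μ Z - ∑ Z ∈ Finset.univ.filter (fun Z => ∀ w ∈ hubbardTermSupp G Z, ¬ ∃ r ∈ ({a, b} : Finset Λ),
        Relation.ReflTransGen (fun x y : Λ => ∃ Z ∈ K, x ∈ hubbardTermSupp G Z ∧ y ∈ hubbardTermSupp G Z) r w),
        hubbardTermOp G t U μ Z‖ ≤ (2 + 2 * K.card) * (2 * Δ + 1) * (2 * |t| + |U| + 2 * |μ|) := by
  rw [← Finset.sum_sdiff (Finset.subset_univ (Finset.univ.filter (fun Z => ∀ w ∈ hubbardTermSupp G Z,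
      ¬ ∃ r ∈ ({a, b} : Finset Λ), Relation.ReflTransGen
        (fun x y : Λ => ∃ Z ∈ K, x ∈ hubbardTermSupp G Z ∧ y ∈ hubbardTermSupp G Z) r w))), add_sub_cancel_right]
  have hsd : Finset.univ \ Finset.univ.filter (fun Z => ∀ w ∈ hubbardTermSupp G Z, ¬ ∃ r ∈ ({a, b} : Finset Λ),
      Relation.ReflTransGen (fun x y : Λ => ∃ Z ∈ K, x ∈ hubbardTermSupp G Z ∧ y ∈ hubbardTermSupp G Z) r w) =
      Finset.univ.filter (fun Z : HubbardIdx G => ¬ ∀ w ∈ hubbardTermSupp G Z, ¬ ∃ r ∈ ({a, b} : Finset Λ),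
        Relation.ReflTransGen (fun x y : Λ => ∃ Z ∈ K, x ∈ hubbardTermSupp G Z ∧ y ∈ hubbardTermSupp G Z) r w) := by
    ext Z; simp only [Finset.mem_sdiff, Finset.mem_filter, Finset.mem_univ, true_and]
  rw [hsd]
  refine (norm_sum_le _ _).trans ?_
  calc ∑ Z ∈ Finset.univ.filter (fun Z : HubbardIdx G => ¬ ∀ w ∈ hubbardTermSupp G Z, ¬ ∃ r ∈ ({a, b} : Finset Λ),
        Relation.ReflTransGen (fun x y : Λ => ∃ Z ∈ K, x ∈ hubbardTermSupp G Z ∧ y ∈ hubbardTermSupp G Z) r w),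
        ‖hubbardTermOp G t U μ Z‖
      ≤ ∑ _Z ∈ Finset.univ.filter (fun Z : HubbardIdx G => ¬ ∀ w ∈ hubbardTermSupp G Z, ¬ ∃ r ∈ ({a, b} : Finset Λ),
        Relation.ReflTransGen (fun x y : Λ => ∃ Z ∈ K, x ∈ hubbardTermSupp G Z ∧ y ∈ hubbardTermSupp G Z) r w),
        (2 * |t| + |U| + 2 * |μ|) := Finset.sum_le_sum fun Z _ => norm_hubbardTermOp_le G t U μ Z
    _ ≤ (2 + 2 * K.card) * (2 * Δ + 1) * (2 * |t| + |U| + 2 * |μ|) := by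
        rw [Finset.sum_const, nsmul_eq_mul]
        have h := card_not_far_le G hΔ a b K
        have hE : 0 ≤ 2 * |t| + |U| + 2 * |μ| := by positivity
        exact mul_le_mul_of_nonneg_right (by exact_mod_cast h) hE

end Summit.Ventures.CertifiedManyBodySolver.Theorems.TcThermcert1.HighTempCurrentClustering

end
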